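import Mathlib
import HarnessLib
import Summits.NavierStokesRegularity.FluidComputer.TriggeredTransferGluing

/-!
# Fluid computer, door N1-FC — triggered transfers with a SUP-CEILING on each piece (`StepB`, `TransfersB`), bounded runs, and ceilings of the glued fields

Cell `ns-blowup`, seat `ns-blowup-fc-prover-2` (D-0074 GROUP C «bridge support»); companion of
`TriggeredTransferRun.lean` / `…Clock` / `…Pieces` / `…Gluing` (seat `ns-blowup-fc-prover-1`: `Link`,
`Run`, the placed pieces `vel n` and the glued fields `gvel n` on `[0, stop n)`) and of
`ClayBreakdownWitnessBounded.lean` (this seat: a witness BOUNDED on closed sub-slabs gives Fefferman's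
(C) with NO named fact). LABEL: E–C typing/bookkeeping. WHAT THIS IS NOT: not Navier–Stokes evidence —
`StepB`/`TransfersB` are OPEN predicates (never asserted) and the theorems are implications; no scheme
instance is claimed.

The door's `Step` delivers an exact classical solution on a compact time slab but says nothing about
its SUPREMUM over `ℝ³`; every actual construction (a designed transfer, a DNS-shadowed gadget) comes
with a velocity ceiling on its slab. Typing that ceiling in costs the physics nothing and buys the
binder-free endpoint: the glued cascade is then bounded on every closed sub-slab `[0, T']`, `T' < T*`.

* `TriggerScheme.StepB ν U ε w := ∃ L : Link ν U ε w, ∃ M, ∀ t ∈ [0, T + δ], ∀ x, ‖L.u t x‖ ≤ M`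
  (one triggered transfer WITH a sup-ceiling on its piece), `TransfersB ν` (from every member, every
  amplitude `≥ U⋆`, every admissible seed); `StepB.step`, `TransfersB.transfers` (forget the ceiling);
* `Run.PiecesBounded ρ` and **`exists_boundedRun : 0 < ν → TransfersB ν → ∃ ρ : Run ν, ρ.PiecesBounded`**
  (the dependent choice of `nonempty_run`, keeping the ceilings);
* ceilings of the placed and glued fields: `Run.vel_norm_le` (`‖vel n‖ ≤ λⁿ Mₙ` on the physical slab
  of level `n`), **`Run.gvel_norm_le`** (`gvel n` is bounded on `[0, stop n)` — finitely many pieces).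

The last step — `PiecesBounded ⇒` the cascade's `BreakdownWitness` is `BoundedOnSlabs`, hence
`TransfersB ν → NavierStokesBreakdownR3` with zero named facts — follows in the companion file once
the witness of seat `ns-blowup-fc-prover-1` is in the tree. [cite: Tao2016AveragedNS, §1.3]
0 sorry; axioms ⊆ {propext, Classical.choice, Quot.sound}.
-/

noncomputable section

namespace Summit.NavierStokesRegularity.FluidComputer.TriggeredTransfer

open Set MeasureTheory Function Filter
open scoped ENNReal ContDiff NNReal Topology
open Literature.Analysis.FluidPDE
open Literature.Analysis.FluidPDE.FluidComputer (E3 Vel)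

namespace TriggerScheme

variable (𝒮 : TriggerScheme)

/-! ## The bounded step and the bounded transfer predicate -/

/-- **One triggered transfer WITH A SUP-CEILING on its piece** at viscosity `ν`, from `w` at
amplitude `U`, seed `ε`: the data of `TriggerScheme.Step` (a `Link`: hand-over time, margin, trigger,
exact classical solution on `[0, T + δ]` from `w` with finite energy, exact hand-over to a zoomed
member one level up) together with a bound `‖u t x‖ ≤ M` on the whole slab. The v2 re-typing of the
door's step; open, never asserted. [cite: Tao2016AveragedNS, §1.3] -/
def StepB (ν U ε : ℝ) (w : Vel) : Prop :=
  ∃ L : 𝒮.Link ν U ε w, ∃ M : ℝ, ∀ t ∈ Icc 0 (L.T + L.δ), ∀ x, ‖L.u t x‖ ≤ M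

/-- **The scheme transfers WITH CEILINGS at viscosity `ν`**: from every member at every amplitude
`U ≥ U⋆`, for every admissible seed (`0 < ε ≤ 1`, `ν |log ε| ≤ a U`), one bounded triggered transfer.
Open; never asserted. [cite: Tao2016AveragedNS, §1.3] -/
def TransfersB (ν : ℝ) : Prop :=
  ∀ U, 𝒮.UStar ≤ U → ∀ w ∈ 𝒮.F U, ∀ ε : ℝ, 0 < ε → ε ≤ 1 → ν * |Real.log ε| ≤ 𝒮.a * U →
    𝒮.StepB ν U ε w

variable {𝒮}

/-- Forgetting the ceiling: a bounded step is a step. [folklore] -/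
theorem StepB.step {ν U ε : ℝ} {w : Vel} (h : 𝒮.StepB ν U ε w) : 𝒮.Step ν U ε w := by
  obtain ⟨L, -⟩ := h
  exact 𝒮.step_iff_nonempty_link.2 ⟨L⟩

/-- Forgetting the ceilings: a scheme transferring with ceilings transfers. [folklore] -/
theorem TransfersB.transfers {ν : ℝ} (h : 𝒮.TransfersB ν) : 𝒮.Transfers ν :=
  fun U hU w hw ε hε hε1 hadm => (h U hU w hw ε hε hε1 hadm).step

/-! ## Bounded runs -/

/-- **The pieces of a run are bounded**: every level's unit-scale piece has a sup-ceiling on its slab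
`[0, T n + δ n]`. [folklore] -/
def Run.PiecesBounded {ν : ℝ} (ρ : 𝒮.Run ν) : Prop :=
  ∀ n, ∃ M : ℝ, ∀ t ∈ Icc 0 ((ρ.link n).T + (ρ.link n).δ), ∀ x, ‖(ρ.link n).u t x‖ ≤ M

/-- **Dependent choice with ceilings**: a scheme transferring with ceilings at viscosity `ν > 0` has a
linked run whose pieces are bounded (the construction of `nonempty_run`, choosing at every level a
link TOGETHER with its ceiling). [cite: Tao2016AveragedNS, §1.3] -/
theorem exists_boundedRun {ν : ℝ} (hν : 0 < ν) (hT : 𝒮.TransfersB ν) :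
    ∃ ρ : 𝒮.Run ν, ρ.PiecesBounded := by
  classical
  -- admissible states
  let X := {q : ℝ × Vel // 𝒮.UStar ≤ q.1 ∧ q.2 ∈ 𝒮.F q.1}
  -- links with a ceiling
  let Y : ℕ → X → Type := fun n q =>
    {L : 𝒮.Link ν q.1.1 (𝒮.seedAt ν n q.1.1) q.1.2 //
      ∃ M : ℝ, ∀ t ∈ Icc 0 (L.T + L.δ), ∀ x, ‖L.u t x‖ ≤ M}
  have key : ∀ (n : ℕ) (q : X), Nonempty (Y n q) := by
    intro n q
    have hU0 : 0 ≤ q.1.1 := 𝒮.UStar_pos.le.trans q.2.1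
    obtain ⟨L, hL⟩ := hT q.1.1 q.2.1 q.1.2 q.2.2 _ (𝒮.seedAt_pos ν n _)
      (𝒮.seedAt_le_one hν n hU0) (𝒮.seedAt_admissible hν n hU0)
    exact ⟨⟨L, hL⟩⟩
  let lk : ∀ (n : ℕ) (q : X), Y n q := fun n q => Classical.choice (key n q)
  -- the successor state: the hand-over amplitude and member
  let nx : ℕ → X → X := fun n q =>
    ⟨((lk n q).1.U', (lk n q).1.w'), (lk n q).1.UStar_le_U' q.2.1, (lk n q).1.mem⟩
  obtain ⟨U₀, hU₀, w₀, hw₀⟩ := 𝒮.seed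
  let q₀ : X := ⟨(U₀, w₀), hU₀, hw₀⟩
  let st : ℕ → X := fun n => Nat.rec q₀ (fun k q => nx k q) n
  have hst : ∀ n, st (n + 1) = nx n (st n) := fun n => rfl
  refine ⟨{ U := fun n => (st n).1.1
            w := fun n => (st n).1.2
            link := fun n => (lk n (st n)).1
            UStar_le_zero := hU₀
            mem_zero := hw₀
            U_succ := fun n => by rw [hst n]
            w_succ := fun n => by rw [hst n] }, fun n => ?_⟩
  exact (lk n (st n)).2

namespace Run

variable {ν : ℝ} (ρ : 𝒮.Run ν)

/-! ## Ceilings of the placed and glued fields -/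

/-- **Ceiling of the placed piece**: if the unit-scale piece of level `n` is bounded by `M` on its
slab, the physical piece `vel n` is bounded by `λⁿ M` on `[start n, start n + dur n + margin n]`
(`‖zoom‖ = λⁿ ‖·‖`). [folklore] -/
theorem vel_norm_le_of_bound (n : ℕ) {M : ℝ}
    (hM : ∀ t ∈ Icc 0 ((ρ.link n).T + (ρ.link n).δ), ∀ x, ‖(ρ.link n).u t x‖ ≤ M) :
    ∀ t ∈ Icc (ρ.start n) (ρ.start n + ρ.dur n + ρ.margin n), ∀ x,
      ‖ρ.vel n t x‖ ≤ 𝒮.mag n * M := by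
  intro t ht x
  rw [ρ.vel_apply, norm_smul, Real.norm_of_nonneg (𝒮.mag_pos n).le]
  exact mul_le_mul_of_nonneg_left (hM _ (ρ.loc_mem n ht) _) (𝒮.mag_pos n).le

/-- **Ceiling of the placed pieces of a bounded run.** [folklore] -/
theorem vel_norm_le (hB : ρ.PiecesBounded) (n : ℕ) :
    ∃ B : ℝ, ∀ t ∈ Icc (ρ.start n) (ρ.start n + ρ.dur n + ρ.margin n), ∀ x, ‖ρ.vel n t x‖ ≤ B := by
  obtain ⟨M, hM⟩ := hB n
  exact ⟨𝒮.mag n * M, ρ.vel_norm_le_of_bound n hM⟩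

/-- **Ceiling of the glued field**: for a bounded run, `gvel n` is bounded on `[0, stop n)` (the
maximum of finitely many piece ceilings; the recursion of `gvel_energy`). [folklore] -/
theorem gvel_norm_le (hB : ρ.PiecesBounded) :
    ∀ n, ∃ B : ℝ, ∀ t ∈ Ico 0 (ρ.stop n), ∀ x, ‖ρ.gvel n t x‖ ≤ B
  | 0 => by
      obtain ⟨B, hb⟩ := ρ.vel_norm_le hB 0
      refine ⟨B, fun t ht x => hb t ⟨?_, ht.2.le.trans (ρ.stop_le_life 0)⟩ x⟩
      rw [ρ.start_zero]; exact ht.1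
  | n + 1 => by
      obtain ⟨B₁, hb₁⟩ := gvel_norm_le hB n
      obtain ⟨B₂, hb₂⟩ := ρ.vel_norm_le hB (n + 1)
      refine ⟨max B₁ B₂, fun t ht x => ?_⟩
      by_cases h : t < ρ.stop n
      · rw [ρ.gvel_succ_apply_of_lt h]
        exact (hb₁ t ⟨ht.1, h⟩ x).trans (le_max_left _ _)
      · rw [ρ.gvel_succ_apply_of_le (not_lt.1 h)]
        refine (hb₂ t ⟨?_, ht.2.le.trans (ρ.stop_le_life (n + 1))⟩ x).trans (le_max_right _ _)
        exact (ρ.start_succ_lt_stop n).le.trans (not_lt.1 h)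

/-- **Uniform ceiling before any `T' < T*`**: for a bounded run and `T' < stop N`, the glued field
through ANY later level `m ≥ N` is bounded on `[0, T']` by the level-`N` ceiling (stability of the
gluing before `stop N`). [folklore] -/
theorem gvel_norm_le_of_lt_stop (hB : ρ.PiecesBounded) {T' : ℝ} {N : ℕ} (hT' : T' < ρ.stop N) :
    ∃ B : ℝ, ∀ m, N ≤ m → ∀ t ∈ Icc 0 T', ∀ x, ‖ρ.gvel m t x‖ ≤ B := by
  obtain ⟨B, hb⟩ := ρ.gvel_norm_le hB N
  refine ⟨B, fun m hm t ht x => ?_⟩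
  have htN : t < ρ.stop N := lt_of_le_of_lt ht.2 hT'
  rw [ρ.gvel_apply_of_lt_stop hm htN]
  exact hb t ⟨ht.1, htN⟩ x

end Run

end TriggerScheme

end Summit.NavierStokesRegularity.FluidComputer.TriggeredTransfer

end
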